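import Summits.Ventures.CertifiedManyBodySolver.Transport.LTIPrimalHubbardPrelude
import Literature.MathematicalPhysics.QuantumLattice.HubbardChainEnergyDensityAt
import Literature.MathematicalPhysics.QuantumLattice.LiebFluxPhaseKronecker
import HarnessLib

/-!
# Ventures/CertifiedManyBodySolver — Transport/LTIPrimalHubbardChain.lean

Speedrun cell sr-mbsolver — LIT team (lit-1 gen-5), D-16 r36 / D-18 r72(c): lane-B transport, PRIMAL form, pure `lti(n)`,
FERMION statistics (the Hubbard chain) — the fermion twin of `Transport/LTIPrimalSpinChain.lean` (lit-4, "THEOREM B0").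
HONEST FRAMING: first certified bounds; not a superconductivity verdict; every number certified or labelled float.

WHAT THIS GIVES. For a lane-B `relax = lti(n)` Hubbard-chain row the two readers certify (FORMAT-ltisdp §2(d)) the FINITE
statement `∀ ρ feasible, E ≤ Re tr(h ρ)` over the window variable `ρ : Op (PolySite Λ') 4` — a density matrix on the qudit space
of the window `Λ' ⊂ ℤ` in the Jordan–Wigner PRODUCT basis `|k⟩ = |config k⟩` (local basis `siteOcc`) — with the rows of
FORMAT-ltisdp §1 verbatim: `ρ ⪰ 0`, `tr ρ = 1`, `tr_{first site} ρ = tr_{last site} ρ` (`spinPartialTrace` along `Λ₀ ↪ Λ'` and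
`Λ₀ + v ↪ Λ'`), `N_↑ / N_↓` sector zeros, density rows `Re tr(n_{0σ} ρ) = ν`, real entries bounded by one; objective
`h = toSpin (Γ(incl) E_Φ)`. `lti_primal_chain_energyPerSite_ge` transports it BY VALUE to every ring (`E ≤ E₀(ring L, 2nh)/L`
when `ν = nh/L`); `lti_primal_chainEnergyDensity_ge` (`ν = 1/2`) and `lti_primal_chainEnergyDensityAt_ge` (`ν = p/(2q)`) pass to
the thermodynamic limit. No dual object is exported (contrast `Transport/LTIDualHubbardChain.lean`).

PROOF (= FORMAT-ltisdp §2 (a)(b)(c), fermion case). `exists_lti_feasible_chain` builds the honest feasible point: the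
tracial ground state `ω` of the ring sector `(2nh, Sᶻ = 0)` (`Matrix.projState` of `sectorGroundProj`) pulled back along
`Γ' = fermionEmbed (PolySite.toTorusEmb L)` and read in the product basis, `ρ₀ = quditDensity (ω ∘ Γ')`; PSD and trace one
(`posSemidef_and_trace_quditDensity`); LTI because `ω ∘ Γ'` is EVEN (parity = `(-1)^{2nh}`) and translation invariant, so the
Jordan–Wigner strings drop out of both marginals (`spinPartialTrace_quditDensity_of_isLowerSet/_of_even`, Araki–Moriya §4.1);
sector zeros from `ad(N_σ)` (`sum_numberOp_commutator_fermionEmbed`); density `nh/L` and objective `E₀/L` by the translation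
average (`projState_eq_div_of_sum_conj`); finally `ρ = ½(ρ₀ + ρ₀ᵀ)` is real with the same rows and objective, `h` and
`toSpin n_{0σ}` being real symmetric (`fermionEmbed_map_conj`). The transport theorem applies the node at `ρ`.
[cite: KullEtAl2024, §II.B, §VI.B] [cite: Han2020Bootstrap, §2] [cite: ArakiMoriya2003, §4.1] [cite: Tasaki2020, §2.1–2.2]

NOT COVERED: the coarse-grained `mps(n,D,A)` relaxation (theorem B of R7, lit-4); windows in `d ≥ 2`.
-/

noncomputable section

open Matrix Complex Filter Topology
open scoped ComplexOrder
open Literature.Probability.LatticeModels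
open Literature.MathematicalPhysics.QuantumLattice
open Literature.MathematicalPhysics.QuantumLattice.HubbardWave0
open Literature.MathematicalPhysics.QuantumLattice.ThermodynamicLimit
open Literature.MathematicalPhysics.QuantumLattice.JordanWigner
open Literature.MathematicalPhysics.QuantumManyBody.StateRelaxation

namespace Summit.Ventures.CertifiedManyBodySolver.Transport
/-! ### The by-value node of a `relax = lti(n)` Hubbard-chain row and its transport to every ring -/

section Ring

/-! **The by-value node** is the unbundled statement `∀ ρ, ρ ⪰ 0 → tr ρ = 1 → tr_{Λ'∖(Λ₀+v)} ρ = tr_{Λ'∖Λ₀} ρ →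
(N_↑/N_↓-sector zeros) → (Re tr(n_{0σ} ρ) = ν) → (real entries) → (|ρ_{kk'}| ≤ 1) → E ≤ Re tr(h ρ)` over the window variable
`ρ : Op (PolySite Λ') 4` (Jordan–Wigner product basis `|k⟩`, `k : PolySite Λ' → Fin 4`, local basis `|0⟩,|↑⟩,|↓⟩,|↑↓⟩ = siteOcc`),
`h = toSpin (Γ(incl) E_Φ)`; the spin-`σ` count of `|k⟩` is `Σ_x [σ ∈ siteOcc (k x)]`. [cite: KullEtAl2024, §II.B eq. (locTIn)] -/

variable {L : ℕ} [NeZero L]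

/-- (Local to this section, as in THE MODEL's torus files.) Torus sites are compared through the linear order. [folklore] -/
local instance (priority := high) instDecidableEqFermionTorusLTIPrimal : DecidableEq (FermionTorus 1 L) :=
  LinearOrder.toDecidableEq

omit [NeZero L] in
/-- The inclusion of windows `Λ₀ ⊆ Λ'` is strictly monotone for the lexicographic site orders. [folklore] -/
theorem strictMono_incl {d : ℕ} {Λ₀ Λ' : Finset (Site d)} (h : Λ₀ ⊆ Λ') : StrictMono (PolySite.incl h) :=
  fun _ _ hab => hab

/-- **The honest feasible point (non-vacuity of the node, with the ring's energy).** For the window data of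
`lti_primal_chain_energyPerSite_ge` some window variable `ρ` satisfies every row of the node with density `nh/L` and has objective
value exactly `E₀(ring L, 2nh)/L` (construction in the module docstring); the interface a coarse-grained (`mps(n,D,A)`) fermion
transport starts from. [cite: KullEtAl2024, §II.B, §VI.B] [cite: ArakiMoriya2003, §4.1] -/
theorem exists_lti_feasible_chain (t U : ℝ) (hL : 3 ≤ L) {nh : ℕ} (hn : nh ≤ L)
    {Λ₀ Λ' : Finset (Site 1)} (h₀ : Λ₀ ⊆ Λ') (v : Site 1) (hsh : affShiftSet 1 v Λ₀ ⊆ Λ')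
    (h0 : thicken ({0} : Finset (Site 1)) 1 ⊆ Λ') (hz : (0 : Site 1) ∈ Λ')
    (hInj : Set.InjOn (Torus.proj (d := 1) L) ↑Λ')
    (hlow : IsLowerSet (Set.range (PolySite.incl h₀)))
    (hmono : StrictMono ((PolySite.affEmb 1 v Λ₀).trans (PolySite.incl hsh)))
    (hconv : (Set.range ((PolySite.affEmb 1 v Λ₀).trans (PolySite.incl hsh))).OrdConnected) :
    ∃ ρ : Op (PolySite Λ') 4, ρ.PosSemidef ∧ ρ.trace = 1 ∧
      spinPartialTrace ((PolySite.affEmb 1 v Λ₀).trans (PolySite.incl hsh)) ρ = spinPartialTrace (PolySite.incl h₀) ρ ∧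
      (∀ σ : Fin 2, ∀ k k' : TensorIndex (PolySite Λ') 4,
        (∑ x, if σ ∈ siteOcc (k x) then 1 else 0 : ℕ) ≠ (∑ x, if σ ∈ siteOcc (k' x) then 1 else 0 : ℕ) → ρ k k' = 0) ∧
      (∀ σ : Fin 2, ((toSpin (nAt 0 hz σ) * ρ).trace).re = (nh : ℝ) / (L : ℝ)) ∧
      (∀ k k' : TensorIndex (PolySite Λ') 4, starRingEnd ℂ (ρ k k') = ρ k k') ∧
      (∀ k k' : TensorIndex (PolySite Λ') 4, ‖ρ k k'‖ ≤ 1) ∧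
      ((toSpin (fermionEmbed (PolySite.incl h0) ((hubbardFermionInteraction 1 t U).meanEnergyObs 1)) * ρ).trace).re =
        energyPerSite (hubbardChain L) t U (2 * nh) := by
  classical
  have hcard : Fintype.card (FermionTorus 1 L) = L := by simp [FermionTorus, Fintype.card_lex]
  have hn' : nh ≤ Fintype.card (FermionTorus 1 L) := by rw [hcard]; exact hn
  set A := hubbardTorus 1 L t U with hAdef
  set K : Submodule ℂ (Fock (Orb (FermionTorus 1 L))) := szSector (2 * nh) 0 with hKdef
  have hA : A.IsHermitian := hubbardTorus_isHermitian (hamiltonian_isHermitian_and_commute_holds _) t U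
  have hKA : ∀ ψ ∈ K, A *ᵥ ψ ∈ K := fun ψ hψ => mulVec_hubbardTorus_mem_szSector t U hψ
  have hK : K ≠ ⊥ := szSector_ne_bot t U hn'
  set P := A.sectorGroundProj K with hPdef
  have hPh : P.IsHermitian := sectorGroundProj_isHermitian A K
  have hP2 : P * P = P := sectorGroundProj_mul_self A K
  have hP0 : P ≠ 0 := sectorGroundProj_ne_zero hA K hKA hK
  have hPA : P * A = ((A.minEnergyOn K : ℝ) : ℂ) • P := sectorGroundProj_mul hA K
  set ω := P.projState with hωdef
  have hone : ω 1 = 1 := projState_one hPh hP2 hP0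
  have hpos : ∀ B, 0 ≤ ω (Bᴴ * B) := fun B => projState_nonneg hPh hP2 B
  have hPT : ∀ w : TorusSite 1 L, P * (fockTranslate w).val = (fockTranslate w).val * P := fun w =>
    sectorGroundProj_commute hA K (fockTranslate_mul_hubbardTorus w t U)
      (fun ψ hψ => fockTranslate_mulVec_mem_szSector w hψ)
      (fun ψ hψ => fockTranslate_conjTranspose_mulVec_mem_szSector w hψ)
  have hTT : ∀ w : TorusSite 1 L, (fockTranslate w).valᴴ * (fockTranslate w).val = 1 :=
    fockTranslate_conjTranspose_mul_self
  have hPU : P * (fockAff 1 (Torus.proj L v)).val = (fockAff 1 (Torus.proj L v)).val * P :=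
    sectorGroundProj_commute hA K (fockAff_mul_hubbardTorus 1 _ t U)
      (fun ψ hψ => fockAff_mulVec_mem_szSector 1 _ hψ)
      (fun ψ hψ => fockAff_conjTranspose_mulVec_mem_szSector 1 _ hψ)
  have hUU : (fockAff 1 (Torus.proj L v)).valᴴ * (fockAff 1 (Torus.proj L v)).val = 1 :=
    fockAff_conjTranspose_mul_self 1 _
  -- the spin-`σ` numbers act as the scalar `nh` on the sector
  have hQK : ∀ σ : Fin 2, ∀ ψ ∈ K, (∑ y : FermionTorus 1 L, numberOp y σ) *ᵥ ψ = ((nh : ℝ) : ℂ) • ψ := by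
    intro σ ψ hψ
    rw [spinNumber_mulVec_of_mem_szSector σ hψ]
    congr 1
    push_cast
    ring
  set Γ' := fermionEmbed (PolySite.toTorusEmb L hInj) with hΓ'def
  set ωW : FermionOp Λ' →ₗ[ℂ] ℂ := ω ∘ₗ (Γ' : FermionOp Λ' →ₐ[ℂ] _).toLinearMap with hωWdef
  have hωW : ∀ Y, ωW Y = ω (Γ' Y) := fun Y => by
    rw [hωWdef, LinearMap.comp_apply, AlgHom.toLinearMap_apply]
  set ρ₀ : Op (PolySite Λ') 4 := quditDensity ωW with hρ₀def
  have hρ₀ : ρ₀.PosSemidef ∧ ρ₀.trace = 1 :=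
    posSemidef_and_trace_quditDensity ωW
      (fun b => by rw [hωW, map_mul, fermionEmbed_conjTranspose]; exact hpos _) (by rw [hωW, map_one, hone])
  -- (2) the window state is EVEN: parity acts as `(-1)^{2nh} = 1` on the sector
  have hPpar : P * parityOp = parityOp * P := by
    have h1 : parityOp * P = P := by
      have h := mul_sectorGroundProj_of_scalar_on A K (Q := parityOp) (q := 1) fun ψ hψ => by
        obtain ⟨hN, -⟩ := (mem_szSector_iff _ _ ψ).1 hψ
        rw [parityOp_mulVec_of_isNParticle hN, pow_mul, neg_one_sq, one_pow]
      rwa [one_smul] at h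
    have h2 : P * parityOp = P := by
      have h := congrArg Matrix.conjTranspose h1
      rwa [Matrix.conjTranspose_mul, hPh.eq, JWSplit.parityOp_conjTranspose] at h
    rw [h1, h2]
  have hPP : (parityOp : Matrix (Finset (Orb (FermionTorus 1 L))) (Finset (Orb (FermionTorus 1 L))) ℂ)ᴴ * parityOp = 1 := by
    rw [JWSplit.parityOp_conjTranspose]; exact JWSplit.parityOp_mul_parityOp
  have heven : ∀ a, ωW (parityAut a) = ωW a := by
    intro a
    have h : ω (parityOp * Γ' a * parityOpᴴ) = ω (Γ' a) := projState_conj hPpar hPP (Γ' a)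
    rw [JWSplit.parityOp_conjTranspose] at h
    rw [hωW, hωW, hΓ'def, fermionEmbed_parityAut, parityAut_apply, ← hΓ'def]
    exact h
  have hLTI₀ : spinPartialTrace ((PolySite.affEmb 1 v Λ₀).trans (PolySite.incl hsh)) ρ₀ =
      spinPartialTrace (PolySite.incl h₀) ρ₀ := by
    have hconj : ∀ Z, ω ((fockAff 1 (Torus.proj L v)).val * Z * (fockAff 1 (Torus.proj L v)).valᴴ) = ω Z :=
      fun Z => projState_conj hPU hUU Z
    have hfun : ωW ∘ₗ (fermionEmbed ((PolySite.affEmb 1 v Λ₀).trans (PolySite.incl hsh))).toLinearMap =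
        ωW ∘ₗ (fermionEmbed (PolySite.incl h₀)).toLinearMap := by
      refine LinearMap.ext fun Y => ?_
      have hdiff := congrArg ω (fermionEmbed_toTorusEmb_aff_sub h₀ 1 v hsh hInj Y)
      rw [map_sub, map_sub, map_sub, hconj, sub_self, sub_eq_zero] at hdiff
      simp only [LinearMap.comp_apply, AlgHom.toLinearMap_apply]
      rw [hωW, hωW, ← fermionEmbed_fermionEmbed]
      exact hdiff
    rw [hρ₀def, spinPartialTrace_quditDensity_of_even _ hmono hconv ωW heven,
      spinPartialTrace_quditDensity_of_isLowerSet _ (strictMono_incl h₀) hlow ωW, hfun]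
  have hsec₀ : ∀ σ : Fin 2, ∀ k k' : TensorIndex (PolySite Λ') 4,
      (∑ x, if σ ∈ siteOcc (k x) then 1 else 0 : ℕ) ≠ (∑ x, if σ ∈ siteOcc (k' x) then 1 else 0 : ℕ) → ρ₀ k k' = 0 := by
    intro σ k k' hne
    set Q : Matrix (Finset (Orb (FermionTorus 1 L))) (Finset (Orb (FermionTorus 1 L))) ℂ :=
      ∑ y : FermionTorus 1 L, numberOp y σ with hQdef
    have hQP : (Q - ((nh : ℝ) : ℂ) • (1 : Matrix _ _ ℂ)) * P = 0 := sub_smul_mul_sectorGroundProj A K (hQK σ)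
    have hPQ : P * (Q - ((nh : ℝ) : ℂ) • (1 : Matrix _ _ ℂ)) = 0 :=
      sectorGroundProj_mul_sub_smul A K (isHermitian_sum_numberOp σ) (hQK σ)
    have hωcomm : ∀ Y, ω (Q * Y - Y * Q) = 0 := by
      intro Y
      have h1 : ω ((Q - ((nh : ℝ) : ℂ) • (1 : Matrix _ _ ℂ)) * Y) = 0 := projState_mul_of_mul_eq_zero' hPQ Y
      have h2 : ω (Y * (Q - ((nh : ℝ) : ℂ) • (1 : Matrix _ _ ℂ))) = 0 := projState_mul_of_mul_eq_zero hQP Y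
      have e : Q * Y - Y * Q = (Q - ((nh : ℝ) : ℂ) • (1 : Matrix _ _ ℂ)) * Y - Y * (Q - ((nh : ℝ) : ℂ) • (1 : Matrix _ _ ℂ)) := by
        rw [sub_mul, mul_sub, smul_mul_assoc, mul_smul_comm, one_mul, mul_one]
        abel
      rw [e, map_sub, h1, h2, sub_zero]
    set E₁ : FermionOp Λ' := Matrix.single (config k') (config k) (1 : ℂ) with hE₁def
    have hentry : ρ₀ k k' = ω (Γ' E₁) := by
      rw [hρ₀def, quditDensity, densityAlong_apply, spinEmbed_refl, LinearMap.comp_apply, AlgEquiv.toLinearMap_apply,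
        toSpin_symm_single, hωW]
    have hcommE : Q * Γ' E₁ - Γ' E₁ * Q =
        (((∑ x, if σ ∈ siteOcc (k' x) then 1 else 0 : ℕ) : ℂ) - ((∑ x, if σ ∈ siteOcc (k x) then 1 else 0 : ℕ) : ℂ)) •
          Γ' E₁ := by
      rw [hQdef, hΓ'def, sum_numberOp_commutator_fermionEmbed, sum_numberOp_eq_diagonal, hE₁def,
        diagonal_commutator_single, map_smul, sum_ite_orb_mem_config, sum_ite_orb_mem_config]
    have h0 := hωcomm (Γ' E₁)
    rw [hcommE, map_smul, smul_eq_mul, mul_eq_zero] at h0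
    rcases h0 with h | h
    · exact absurd (by exact_mod_cast (sub_eq_zero.1 h).symm) hne
    · rw [hentry]
      exact h
  have hdens₀ : ∀ σ : Fin 2, ((toSpin (nAt 0 hz σ) * ρ₀).trace).re = (nh : ℝ) / (L : ℝ) := by
    intro σ
    have hPG : P * (∑ y : FermionTorus 1 L, numberOp y σ) = ((nh : ℝ) : ℂ) • P := by
      have h := sectorGroundProj_mul_sub_smul A K (isHermitian_sum_numberOp σ) (hQK σ)
      rw [Matrix.mul_sub, Matrix.mul_smul, Matrix.mul_one, sub_eq_zero] at h
      exact h
    have hD : ω (numberOp (FermionTorus.ofTorusSite (0 : TorusSite 1 L)) σ) =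
        ((nh : ℝ) : ℂ) / (Fintype.card (TorusSite 1 L) : ℂ) :=
      projState_eq_div_of_sum_conj hPh hP2 hP0 hPG (fun w => (fockTranslate w).val) hPT hTT
        (sum_conj_fockTranslate_numberOp 0 σ)
    rw [hρ₀def, trace_toSpin_mul_quditDensity, hωW, hΓ'def, fermionEmbed_toTorusEmb_nAt_zero hz hInj σ, hD,
      Literature.MathematicalPhysics.QuantumLattice.card_torusSite, pow_one]
    have e : ((nh : ℝ) : ℂ) / ((L : ℕ) : ℂ) = (((nh : ℝ) / (L : ℝ) : ℝ) : ℂ) := by push_cast; rfl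
    rw [e, Complex.ofReal_re]
  -- (6) the real symmetric point `ρ = ½ (ρ₀ + ρ₀ᵀ)`
  set ρ : Op (PolySite Λ') 4 := (1 / 2 : ℂ) • (ρ₀ + ρ₀ᵀ) with hρdef
  have hherm₀ : ρ₀.IsHermitian := hρ₀.1.1
  have hρT : ρ₀ᵀ.PosSemidef := hρ₀.1.transpose
  have hρpsd : ρ.PosSemidef := by
    have hsum : (ρ₀ + ρ₀ᵀ).PosSemidef := hρ₀.1.add hρT
    have h2 : (0 : ℂ) ≤ 1 / 2 := by rw [Complex.le_def]; simp
    exact hsum.smul h2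
  have hρtr : ρ.trace = 1 := by
    rw [hρdef, trace_smul, trace_add, trace_transpose, hρ₀.2, smul_eq_mul]
    norm_num
  have hρLTI : spinPartialTrace ((PolySite.affEmb 1 v Λ₀).trans (PolySite.incl hsh)) ρ =
      spinPartialTrace (PolySite.incl h₀) ρ := by
    rw [hρdef, map_smul, map_smul, map_add, map_add, spinPartialTrace_transpose, spinPartialTrace_transpose, hLTI₀]
  have hρsec : ∀ σ : Fin 2, ∀ k k' : TensorIndex (PolySite Λ') 4,
      (∑ x, if σ ∈ siteOcc (k x) then 1 else 0 : ℕ) ≠ (∑ x, if σ ∈ siteOcc (k' x) then 1 else 0 : ℕ) → ρ k k' = 0 := by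
    intro σ k k' hne
    rw [hρdef, Matrix.smul_apply, Matrix.add_apply, transpose_apply, hsec₀ σ k k' hne, hsec₀ σ k' k (Ne.symm hne),
      add_zero, smul_zero]
  have hρreal : ∀ k k' : TensorIndex (PolySite Λ') 4, starRingEnd ℂ (ρ k k') = ρ k k' := by
    intro k k'
    have h1 : starRingEnd ℂ (ρ₀ k k') = ρ₀ k' k := by simpa [Complex.star_def] using hherm₀.apply k' k
    have h2 : starRingEnd ℂ (ρ₀ k' k) = ρ₀ k k' := by simpa [Complex.star_def] using hherm₀.apply k k'
    rw [hρdef, Matrix.smul_apply, Matrix.add_apply, transpose_apply, smul_eq_mul, map_mul, map_add, h1, h2,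
      map_div₀, map_one, map_ofNat, add_comm]
  have hρbd : ∀ k k' : TensorIndex (PolySite Λ') 4, ‖ρ k k'‖ ≤ 1 := norm_apply_le_one_of_posSemidef hρpsd hρtr
  -- real symmetric observables have the same expectation in `ρ` and `ρ₀`
  have hsymm : ∀ X : Op (PolySite Λ') 4, Xᵀ = X → (X * ρ).trace = (X * ρ₀).trace := by
    intro X hX
    have h1 : (X * ρ₀ᵀ).trace = (X * ρ₀).trace := by
      rw [← trace_transpose, transpose_mul, transpose_transpose, hX, trace_mul_comm]
    rw [hρdef, Matrix.mul_smul, Matrix.mul_add, trace_smul, trace_add, h1, smul_eq_mul]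
    ring
  have hnT : ∀ σ : Fin 2, (toSpin (nAt 0 hz σ) : Op (PolySite Λ') 4)ᵀ = toSpin (nAt 0 hz σ) := fun σ =>
    transpose_eq_of_isHermitian_of_map_conj
      (by rw [Matrix.IsHermitian, ← toSpin_conjTranspose, nAt, numberOp, Matrix.conjTranspose_mul,
        annihilation_conjTranspose, creation_conjTranspose])
      (by rw [toSpin_map, nAt, numberOp_map_conj])
  have hρdens : ∀ σ : Fin 2, ((toSpin (nAt 0 hz σ) * ρ).trace).re = (nh : ℝ) / (L : ℝ) := by
    intro σ
    rw [hsymm _ (hnT σ)]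
    exact hdens₀ σ
  -- (7) the objective: real symmetric, and `Re tr(h ρ₀) = ω(Γ' Γ(incl) E_Φ) = E₀ / L`
  set h : Op (PolySite Λ') 4 :=
    toSpin (fermionEmbed (PolySite.incl h0) ((hubbardFermionInteraction 1 t U).meanEnergyObs 1)) with hhdef
  have hhT : hᵀ = h := by
    rw [hhdef]
    refine transpose_eq_of_isHermitian_of_map_conj ?_ ?_
    · rw [Matrix.IsHermitian, ← toSpin_conjTranspose, ← fermionEmbed_conjTranspose,
        (hubbard_meanEnergyObs_isHermitian t U 1).eq]
    · rw [toSpin_map, fermionEmbed_map_conj, hubbard_meanEnergyObs_map_conj]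
  have hωX : (h * ρ₀).trace = ((A.minEnergyOn K : ℝ) : ℂ) / (Fintype.card (TorusSite 1 L) : ℂ) := by
    rw [hhdef, hρ₀def, trace_toSpin_mul_quditDensity, hωW]
    have hX0 : Γ' (fermionEmbed (PolySite.incl h0) ((hubbardFermionInteraction 1 t U).meanEnergyObs 1)) =
        fermionEmbed (PolySite.toTorusEmb L (hInj.mono (by exact_mod_cast h0)))
          ((hubbardFermionInteraction 1 t U).meanEnergyObs 1) :=
      fermionEmbed_toTorusEmb_incl h0 hInj _
    have hsum : ∑ w : TorusSite 1 L, (fockTranslate w).val *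
        fermionEmbed (PolySite.toTorusEmb L (hInj.mono (by exact_mod_cast h0)))
          ((hubbardFermionInteraction 1 t U).meanEnergyObs 1) * (fockTranslate w).valᴴ = A := by
      have e := sum_relabel_translate_hubbard_meanEnergyObs (d := 1) t U hL
      simp_rw [relabel_eq_fockRelabel_conj] at e
      exact e
    rw [hX0]
    exact projState_eq_div_of_sum_conj hPh hP2 hP0 hPA (fun w => (fockTranslate w).val) hPT hTT hsum
  refine ⟨ρ, hρpsd, hρtr, hρLTI, hρsec, hρdens, hρreal, hρbd, ?_⟩
  rw [hsymm h hhT, hωX, Literature.MathematicalPhysics.QuantumLattice.card_torusSite, pow_one]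
  have hE : A.minEnergyOn K = groundEnergyAt (fermionTorusGraph 1 L) t U (2 * nh) :=
    (groundEnergyAt_eq_minEnergyOn_szSector (fermionTorusGraph 1 L) t U hn').symm
  have e : ((A.minEnergyOn K : ℝ) : ℂ) / ((L : ℕ) : ℂ) = ((A.minEnergyOn K / (L : ℝ) : ℝ) : ℂ) := by push_cast; rfl
  rw [e, Complex.ofReal_re, hE, energyPerSite, hcard]

/-- **THEOREM B0, fermion case (ring form): the primal `lti(n)` statement bounds every ring.** Data: a window `Λ' ⊂ ℤ`
containing `{-1, 0, 1}` (`h0`) with `x ↦ x mod L` injective on it; a sub-window `Λ₀ ⊆ Λ'` forming an initial segment (`hlow`)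
whose translate `Λ₀ + v ⊆ Λ'` is an order-interval (`hmono`, `hconv`; e.g. `Λ' = {a, …, b}`, `Λ₀ = {a, …, b-1}`, `v = 1`);
density target `ν = nh/L`. If `E ≤ Re tr(h ρ)` for every window variable satisfying the rows of the node, then
`E ≤ E₀(ring L, N = 2nh)/L` for every `L ≥ 3`, `nh ≤ L`. [cite: KullEtAl2024, §II.B, §VI.B] [cite: Han2020Bootstrap, §2] -/
theorem lti_primal_chain_energyPerSite_ge (t U : ℝ) (hL : 3 ≤ L) {nh : ℕ} (hn : nh ≤ L)
    {Λ₀ Λ' : Finset (Site 1)} (h₀ : Λ₀ ⊆ Λ') (v : Site 1) (hsh : affShiftSet 1 v Λ₀ ⊆ Λ')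
    (h0 : thicken ({0} : Finset (Site 1)) 1 ⊆ Λ') (hz : (0 : Site 1) ∈ Λ')
    (hInj : Set.InjOn (Torus.proj (d := 1) L) ↑Λ')
    (hlow : IsLowerSet (Set.range (PolySite.incl h₀)))
    (hmono : StrictMono ((PolySite.affEmb 1 v Λ₀).trans (PolySite.incl hsh)))
    (hconv : (Set.range ((PolySite.affEmb 1 v Λ₀).trans (PolySite.incl hsh))).OrdConnected)
    {ν E : ℝ} (hν : ν = (nh : ℝ) / (L : ℝ))
    (hclaim : ∀ ρ : Op (PolySite Λ') 4, ρ.PosSemidef → ρ.trace = 1 →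
      spinPartialTrace ((PolySite.affEmb 1 v Λ₀).trans (PolySite.incl hsh)) ρ = spinPartialTrace (PolySite.incl h₀) ρ →
      (∀ σ : Fin 2, ∀ k k' : TensorIndex (PolySite Λ') 4,
        (∑ x, if σ ∈ siteOcc (k x) then 1 else 0 : ℕ) ≠ (∑ x, if σ ∈ siteOcc (k' x) then 1 else 0 : ℕ) → ρ k k' = 0) →
      (∀ σ : Fin 2, ((toSpin (nAt 0 hz σ) * ρ).trace).re = ν) →
      (∀ k k' : TensorIndex (PolySite Λ') 4, starRingEnd ℂ (ρ k k') = ρ k k') →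
      (∀ k k' : TensorIndex (PolySite Λ') 4, ‖ρ k k'‖ ≤ 1) →
      E ≤ ((toSpin (fermionEmbed (PolySite.incl h0) ((hubbardFermionInteraction 1 t U).meanEnergyObs 1)) * ρ).trace).re) :
    E ≤ energyPerSite (hubbardChain L) t U (2 * nh) := by
  obtain ⟨ρ, hρpsd, hρtr, hρLTI, hρsec, hρdens, hρreal, hρbd, hobj⟩ := exists_lti_feasible_chain t U hL hn h₀ v hsh h0 hz hInj hlow hmono hconv
  exact hobj ▸ hclaim ρ hρpsd hρtr hρLTI hρsec (fun σ => (hρdens σ).trans hν.symm) hρreal hρbd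

end Ring

/-! ### Thermodynamic limit: half filling and filling `p/q` -/

section Limit

/-- **THEOREM B0, fermion case (thermodynamic limit, half filling).** With the windows of
`lti_primal_chain_energyPerSite_ge` and the density target `ν = 1/2`: if `E ≤ Re tr(h ρ)` for every feasible window variable,
then `E ≤ hubbardChainEnergyDensity t U` (`U ≥ 0`; the rings `L` even, `N = L`).
[cite: KullEtAl2024, §II.B, §VI.B] [cite: Han2020Bootstrap, §2] [cite: Ruelle1969, §2.2] -/
theorem lti_primal_chainEnergyDensity_ge (t : ℝ) {U : ℝ} (hU : 0 ≤ U)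
    {Λ₀ Λ' : Finset (Site 1)} (h₀ : Λ₀ ⊆ Λ') (v : Site 1) (hsh : affShiftSet 1 v Λ₀ ⊆ Λ')
    (h0 : thicken ({0} : Finset (Site 1)) 1 ⊆ Λ') (hz : (0 : Site 1) ∈ Λ')
    (hlow : IsLowerSet (Set.range (PolySite.incl h₀)))
    (hmono : StrictMono ((PolySite.affEmb 1 v Λ₀).trans (PolySite.incl hsh)))
    (hconv : (Set.range ((PolySite.affEmb 1 v Λ₀).trans (PolySite.incl hsh))).OrdConnected)
    {E : ℝ}
    (hclaim : ∀ ρ : Op (PolySite Λ') 4, ρ.PosSemidef → ρ.trace = 1 →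
      spinPartialTrace ((PolySite.affEmb 1 v Λ₀).trans (PolySite.incl hsh)) ρ = spinPartialTrace (PolySite.incl h₀) ρ →
      (∀ σ : Fin 2, ∀ k k' : TensorIndex (PolySite Λ') 4,
        (∑ x, if σ ∈ siteOcc (k x) then 1 else 0 : ℕ) ≠ (∑ x, if σ ∈ siteOcc (k' x) then 1 else 0 : ℕ) → ρ k k' = 0) →
      (∀ σ : Fin 2, ((toSpin (nAt 0 hz σ) * ρ).trace).re = 1 / 2) →
      (∀ k k' : TensorIndex (PolySite Λ') 4, starRingEnd ℂ (ρ k k') = ρ k k') →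
      (∀ k k' : TensorIndex (PolySite Λ') 4, ‖ρ k k'‖ ≤ 1) →
      E ≤ ((toSpin (fermionEmbed (PolySite.incl h0) ((hubbardFermionInteraction 1 t U).meanEnergyObs 1)) * ρ).trace).re) :
    E ≤ hubbardChainEnergyDensity t U := by
  obtain ⟨L₀, hL₀⟩ := exists_forall_le_injOn_proj Λ'
  refine hubbardChainEnergyDensity_ge_of_forall_ge t hU (max L₀ 3) fun L hL hLe => ?_
  have hL3 : 3 ≤ L := le_trans (le_max_right _ _) hL
  have hLL : L₀ ≤ L := le_trans (le_max_left _ _) hL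
  haveI : NeZero L := ⟨by omega⟩
  obtain ⟨m, hm⟩ := hLe
  have hmL : m ≤ L := by omega
  have hL0 : (L : ℝ) ≠ 0 := Nat.cast_ne_zero.2 (by omega)
  have hν : (1 / 2 : ℝ) = (m : ℝ) / (L : ℝ) := by
    rw [eq_div_iff hL0, hm]
    push_cast
    ring
  have key := lti_primal_chain_energyPerSite_ge (L := L) t U hL3 hmL h₀ v hsh h0 hz (hL₀ L hLL) hlow hmono hconv hν
    hclaim
  rw [energyPerSite_fermionTorusGraph_one] at key
  have h2 : 2 * m = L := by omega
  rw [h2] at key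
  exact key

/-- **THEOREM B0, fermion case (thermodynamic limit, filling `p/q`).** With the windows of
`lti_primal_chain_energyPerSite_ge` and the density target `ν = p/(2q)` per spin (`1 ≤ q`, `p ≤ 2q`, `U ≥ 0`): if
`E ≤ Re tr(h ρ)` for every feasible window variable, then `E ≤ hubbardChainEnergyDensityAt t U p q` (the rings `L = q·2k`,
`N = p·2k`). [cite: KullEtAl2024, §II.B, §VI.B] [cite: Han2020Bootstrap, §2] [cite: Ruelle1969, §2.2] -/
theorem lti_primal_chainEnergyDensityAt_ge (t : ℝ) {U : ℝ} (hU : 0 ≤ U) {p q : ℕ} (hq : 1 ≤ q) (hp : p ≤ 2 * q)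
    {Λ₀ Λ' : Finset (Site 1)} (h₀ : Λ₀ ⊆ Λ') (v : Site 1) (hsh : affShiftSet 1 v Λ₀ ⊆ Λ')
    (h0 : thicken ({0} : Finset (Site 1)) 1 ⊆ Λ') (hz : (0 : Site 1) ∈ Λ')
    (hlow : IsLowerSet (Set.range (PolySite.incl h₀)))
    (hmono : StrictMono ((PolySite.affEmb 1 v Λ₀).trans (PolySite.incl hsh)))
    (hconv : (Set.range ((PolySite.affEmb 1 v Λ₀).trans (PolySite.incl hsh))).OrdConnected)
    {E : ℝ}
    (hclaim : ∀ ρ : Op (PolySite Λ') 4, ρ.PosSemidef → ρ.trace = 1 →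
      spinPartialTrace ((PolySite.affEmb 1 v Λ₀).trans (PolySite.incl hsh)) ρ = spinPartialTrace (PolySite.incl h₀) ρ →
      (∀ σ : Fin 2, ∀ k k' : TensorIndex (PolySite Λ') 4,
        (∑ x, if σ ∈ siteOcc (k x) then 1 else 0 : ℕ) ≠ (∑ x, if σ ∈ siteOcc (k' x) then 1 else 0 : ℕ) → ρ k k' = 0) →
      (∀ σ : Fin 2, ((toSpin (nAt 0 hz σ) * ρ).trace).re = (p : ℝ) / (2 * (q : ℝ))) →
      (∀ k k' : TensorIndex (PolySite Λ') 4, starRingEnd ℂ (ρ k k') = ρ k k') →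
      (∀ k k' : TensorIndex (PolySite Λ') 4, ‖ρ k k'‖ ≤ 1) →
      E ≤ ((toSpin (fermionEmbed (PolySite.incl h0) ((hubbardFermionInteraction 1 t U).meanEnergyObs 1)) * ρ).trace).re) :
    E ≤ hubbardChainEnergyDensityAt t U p q := by
  obtain ⟨L₀, hL₀⟩ := exists_forall_le_injOn_proj Λ'
  refine hubbardChainEnergyDensityAt_ge_of_frequently_ge t hU hq hp (Filter.frequently_atTop.2 fun n => ?_)
  -- the ring `L = q · (2k)` with `nh = p · k`, `k ≥ max n L₀ 3`
  set k : ℕ := max n (max L₀ 3) with hk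
  have hkn : n ≤ k := le_max_left _ _
  have hkL : L₀ ≤ k := le_trans (le_max_left _ _) (le_max_right _ _)
  have hk3 : 3 ≤ k := le_trans (le_max_right _ _) (le_max_right _ _)
  refine ⟨2 * k, by omega, ?_⟩
  have hL3 : 3 ≤ q * (2 * k) := le_trans hk3 (by nlinarith)
  have hLL : L₀ ≤ q * (2 * k) := le_trans hkL (by nlinarith)
  haveI : NeZero (q * (2 * k)) := ⟨by omega⟩
  have hn : p * k ≤ q * (2 * k) := by nlinarith
  have h2q : 2 * (q : ℝ) ≠ 0 := mul_ne_zero two_ne_zero (Nat.cast_ne_zero.2 (by omega))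
  have hqk : ((q * (2 * k) : ℕ) : ℝ) ≠ 0 := Nat.cast_ne_zero.2 (by omega)
  have hν : (p : ℝ) / (2 * (q : ℝ)) = ((p * k : ℕ) : ℝ) / ((q * (2 * k) : ℕ) : ℝ) := by
    rw [div_eq_div_iff h2q hqk]
    push_cast
    ring
  have key := lti_primal_chain_energyPerSite_ge (L := q * (2 * k)) t U hL3 hn h₀ v hsh h0 hz (hL₀ _ hLL) hlow hmono
    hconv hν hclaim
  rw [energyPerSite_fermionTorusGraph_one] at key
  have hN : 2 * (p * k) = p * (2 * k) := by ring
  rw [hN] at key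
  exact key

end Limit

end Summit.Ventures.CertifiedManyBodySolver.Transport
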